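import Mathlib.Analysis.SpecialFunctions.Complex.Log
import Mathlib.LinearAlgebra.Dimension.Constructions
import Mathlib.LinearAlgebra.FiniteDimensional.Basic
import Mathlib.LinearAlgebra.FreeModule.PID
import Mathlib.RingTheory.Algebraic.Integral
import HarnessLib

/-!
# Waldschmidt 1981, §6 a): lattice lemmas for the proof of Théorème 1.1

Topic `Literature/NumberTheory/Transcendental`; sibling of
`SixExponentialsSeveralVariablesSteps.lean` (the named facts of [Waldschmidt1981] §§3–6). This file
collects, PROVED and in the generality in which they hold, the lemmas on finitely generated
subgroups of vector spaces used in §6 a) of the source (the deduction of Théorème 1.1 from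
Proposition 6.1, pp. 109–110):

* `exists_compl_of_saturated` — a saturated subgroup `A` of a finitely generated torsion-free
  abelian group `X` is a direct summand ("On peut évidemment choisir un tel `X₁` qui soit facteur
  direct dans `X`", p. 110; here via the Smith normal form of `A ≤ X`: saturation forces the
  elementary divisors to be units);
* `saturated_inf_restrictScalars` — `X ∩ W` is saturated in `X` for a subspace `W`
  (so `X = (X ∩ W) ⊕ X₂`, and `Y = Y₁ ⊕ (Y ∩ V)`, p. 110);
* `finrank_map_inf_eq` — `rang_ℤ (Γ ∩ U)` is invariant under injective linear maps (used to
  read `μ` in coordinates);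
* `isAlgebraic_cexp_dotProduct_of_mem_span` — if all `exp⟨xᵢ, yⱼ⟩` are algebraic then so is
  `exp⟨u, v⟩` for `u ∈ ∑ ℤxᵢ`, `v ∈ ∑ ℤyⱼ` ("exp⟨s(Y), X₁⟩ ⊂ ℚ̄", p. 110).

## References

* [Waldschmidt1981] M. Waldschmidt, *Transcendance et exponentielles en plusieurs variables*,
  Invent. Math. 63 (1981) 97–127, §6 a) (pp. 109–110).
-/

noncomputable section

open Complex Module

namespace Literature.NumberTheory.Transcendental.Waldschmidt1981

/-! ### (c) a saturated subgroup of a finitely generated torsion-free abelian group is a direct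
summand -/

/-- If `A ≤ X` are subgroups of a torsion-free abelian group, `X` finitely generated and `A`
saturated in `X` (`k z ∈ A`, `k ≠ 0`, `z ∈ X` ⟹ `z ∈ A`), then `A` is a direct summand of
`X`: `X = A ⊕ B`. (The quotient `X/A` is torsion-free and finitely generated, hence free,
hence projective, so `X → X/A` splits.) [folklore] -/
theorem exists_compl_of_saturated {E : Type*} [AddCommGroup E] [IsAddTorsionFree E]
    {X A : Submodule ℤ E} (hX : X.FG) (hA : A ≤ X)
    (hsat : ∀ (k : ℤ) (z : E), k ≠ 0 → z ∈ X → k • z ∈ A → z ∈ A) :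
    ∃ B : Submodule ℤ E, A ⊔ B = X ∧ A ⊓ B = ⊥ := by
  classical
  haveI : Module.Finite ℤ X := Module.Finite.iff_fg.mpr hX
  haveI : IsAddTorsionFree X :=
    Function.Injective.isAddTorsionFree X.subtype.toAddMonoidHom Subtype.val_injective
  haveI : Module.Free ℤ X := Module.free_of_finite_type_torsion_free'
  let b := Module.Free.chooseBasis ℤ X
  set A' : Submodule ℤ X := A.comap X.subtype with hA'def
  obtain ⟨m, snf⟩ := Submodule.smithNormalForm b A'
  -- the diagonal entries are non-zero and, by saturation, the adapted basis vectors lie in `A`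
  have ha : ∀ i, snf.a i ≠ 0 := by
    intro i h
    have h1 := snf.snf i
    rw [h, zero_smul] at h1
    exact snf.bN.ne_zero i (Subtype.ext (by simpa using h1))
  have hmemA : ∀ i, snf.bM (snf.f i) ∈ A' := by
    intro i
    have h1 : snf.a i • snf.bM (snf.f i) ∈ A' := by
      rw [← snf.snf i]; exact (snf.bN i).2
    have h2 : snf.a i • ((snf.bM (snf.f i) : X) : E) ∈ A := by
      simpa [hA'def] using h1
    have := hsat (snf.a i) _ (ha i) (snf.bM (snf.f i)).2 h2
    simpa [hA'def] using this
  have hAspan : A' = Submodule.span ℤ (snf.bM '' Set.range snf.f) := by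
    apply le_antisymm
    · intro z hz
      have hsum := congrArg (fun w : A' => (w : X)) (snf.bN.sum_repr ⟨z, hz⟩).symm
      simp only [Submodule.coe_sum, Submodule.coe_smul_of_tower] at hsum
      rw [show z = _ from hsum]
      refine Submodule.sum_mem _ fun i _ => Submodule.smul_mem _ _ ?_
      rw [snf.snf i]
      exact Submodule.smul_mem _ _ (Submodule.subset_span ⟨snf.f i, ⟨i, rfl⟩, rfl⟩)
    · rw [Submodule.span_le]
      rintro _ ⟨_, ⟨i, rfl⟩, rfl⟩
      exact hmemA i
  set B' : Submodule ℤ X := Submodule.span ℤ (snf.bM '' (Set.range snf.f)ᶜ) with hB'def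
  have hsup : A' ⊔ B' = ⊤ := by
    rw [hAspan, hB'def, ← Submodule.span_union, ← Set.image_union, Set.union_compl_self,
      Set.image_univ, snf.bM.span_eq]
  have hinf : A' ⊓ B' = ⊥ := by
    rw [hAspan, hB'def]
    exact (snf.bM.linearIndependent.disjoint_span_image disjoint_compl_right).eq_bot
  -- transfer the decomposition `X = A' ⊕ B'` to `E`
  refine ⟨B'.map X.subtype, ?_, ?_⟩
  · apply le_antisymm
    · exact sup_le hA (Submodule.map_subtype_le X B')
    · intro z hz
      have htop : (⟨z, hz⟩ : X) ∈ A' ⊔ B' := by rw [hsup]; trivial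
      obtain ⟨a, ha', b', hb', hab⟩ := Submodule.mem_sup.mp htop
      have : z = (a : E) + (b' : E) := by
        have := congrArg (fun w : X => (w : E)) hab
        simpa using this.symm
      rw [this]
      exact Submodule.add_mem_sup (by simpa [hA'def] using ha') ⟨b', hb', rfl⟩
  · rw [eq_bot_iff]
    rintro z ⟨hzA, hzB⟩
    obtain ⟨b', hb', rfl⟩ := hzB
    have hbA : b' ∈ A' := by simpa [hA'def] using hzA
    have : b' ∈ A' ⊓ B' := ⟨hbA, hb'⟩
    rw [hinf, Submodule.mem_bot] at this
    simp [this]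

/-- The part of a subgroup `X` lying in a `K`-subspace `U` is saturated in `X`. [folklore] -/
theorem saturated_inf_restrictScalars {K : Type*} [Field K] [CharZero K] {E : Type*}
    [AddCommGroup E] [Module K E] (X : Submodule ℤ E) (U : Submodule K E) :
    ∀ (k : ℤ) (z : E), k ≠ 0 → z ∈ X → k • z ∈ X ⊓ U.restrictScalars ℤ →
      z ∈ X ⊓ U.restrictScalars ℤ := by
  intro k z hk hz hkz
  refine ⟨hz, ?_⟩
  have h2 : (k : K) • z ∈ U := by
    rw [Int.cast_smul_eq_zsmul]
    exact hkz.2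
  have hkK : (k : K) ≠ 0 := by exact_mod_cast hk
  have := U.smul_mem (k : K)⁻¹ h2
  rwa [smul_smul, inv_mul_cancel₀ hkK, one_smul] at this

/-! ### (b') transport of `rang_ℤ (Γ ∩ U)` along injective linear maps -/

/-- Restricting scalars commutes with pushing forward a subspace. [folklore] -/
theorem restrictScalars_map {K : Type*} [Field K] {V V' : Type*} [AddCommGroup V] [Module K V]
    [AddCommGroup V'] [Module K V'] (f : V →ₗ[K] V') (U : Submodule K V) :
    (U.map f).restrictScalars ℤ = (U.restrictScalars ℤ).map (f.restrictScalars ℤ) := by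
  ext v
  simp [Submodule.mem_map, Submodule.restrictScalars_mem]

/-- `rang_ℤ` of the intersection is invariant under an injective `K`-linear map:
`rank (f Γ ∩ f U) = rank (Γ ∩ U)`. [folklore] -/
theorem finrank_map_inf_eq {K : Type*} [Field K] {V V' : Type*} [AddCommGroup V] [Module K V]
    [AddCommGroup V'] [Module K V'] (f : V →ₗ[K] V') (hf : Function.Injective f)
    (Γ : Submodule ℤ V) (U : Submodule K V) :
    Module.finrank ℤ ↥(Γ.map (f.restrictScalars ℤ) ⊓ (U.map f).restrictScalars ℤ) =
      Module.finrank ℤ ↥(Γ ⊓ U.restrictScalars ℤ) := by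
  have hfZ : Function.Injective (f.restrictScalars ℤ) := hf
  rw [restrictScalars_map, ← Submodule.map_inf _ hfZ]
  exact (LinearEquiv.finrank_eq (Submodule.equivMapOfInjective _ hfZ _)).symm

/-! ### (e) algebraicity of `exp⟨u, v⟩` on the subgroups generated -/

/-- If all `exp⟨xᵢ, yⱼ⟩` are algebraic then `exp⟨u, v⟩` is algebraic for every `u` in the
subgroup generated by the `xᵢ` and `v` in the subgroup generated by the `yⱼ` (`⟨·,·⟩` is
biadditive and `exp` turns sums into products, integer multiples into integer powers).
[cite: Waldschmidt1981, §6 a) (p. 110: "exp⟨s(Y), X₁⟩ ⊂ ℚ̄")] -/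
theorem isAlgebraic_cexp_dotProduct_of_mem_span {n : ℕ} {ι κ : Type*} {x : ι → Fin n → ℂ}
    {y : κ → Fin n → ℂ} (h : ∀ i j, IsAlgebraic ℚ (cexp (x i ⬝ᵥ y j))) {u v : Fin n → ℂ}
    (hu : u ∈ Submodule.span ℤ (Set.range x)) (hv : v ∈ Submodule.span ℤ (Set.range y)) :
    IsAlgebraic ℚ (cexp (u ⬝ᵥ v)) := by
  -- `e^{kx} = (e^x)^k` is algebraic when `e^x` is (cf. the tree's
  -- `Literature.Barriers.Schanuel.isAlgebraic_cexp_int_mul`, restated inline to keep imports light)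
  have hzmul : ∀ {t : ℂ}, IsAlgebraic ℚ (cexp t) → ∀ k : ℤ, IsAlgebraic ℚ (cexp (k * t)) := by
    intro t ht k
    obtain ⟨m, rfl | rfl⟩ := Int.eq_nat_or_neg k
    · rw [Int.cast_natCast, Complex.exp_nat_mul]
      exact ht.pow m
    · rw [Int.cast_neg, Int.cast_natCast, neg_mul, Complex.exp_neg, Complex.exp_nat_mul]
      exact (ht.pow m).inv
  have step : ∀ u ∈ Submodule.span ℤ (Set.range x), ∀ j, IsAlgebraic ℚ (cexp (u ⬝ᵥ y j)) := by
    intro u hu j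
    induction hu using Submodule.span_induction with
    | mem w hw => obtain ⟨i, rfl⟩ := hw; exact h i j
    | zero => rw [zero_dotProduct, Complex.exp_zero]; exact isAlgebraic_one
    | add u u' _ _ hu hu' => rw [add_dotProduct, Complex.exp_add]; exact hu.mul hu'
    | smul k u _ hu =>
      rw [smul_dotProduct, zsmul_eq_mul]
      exact hzmul hu k
  induction hv using Submodule.span_induction with
  | mem w hw => obtain ⟨j, rfl⟩ := hw; exact step u hu j
  | zero => rw [dotProduct_zero, Complex.exp_zero]; exact isAlgebraic_one
  | add v v' _ _ hv hv' => rw [dotProduct_add, Complex.exp_add]; exact hv.mul hv'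
  | smul k v _ hv =>
    rw [dotProduct_smul, zsmul_eq_mul]
    exact hzmul hv k


end Literature.NumberTheory.Transcendental.Waldschmidt1981

end
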